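import Summits.Parity.GeneralizedHardyLittlewood.Theorems.PolymathEpsThreeCeilingAssembly
import Summits.Parity.GeneralizedHardyLittlewood.Theorems.PolymathEpsThreeCeilingGridBoundHigh
import Summits.Parity.GeneralizedHardyLittlewood.Theorems.PolymathEpsThreeCeilingGridBoundLow

/-!
# Route `PolymathEpsThreeCeiling` — target item `EpsThreeLeTwo` (stmt-Parity-19068), by name

`EpsThreeLeTwo := Literature.NumberTheory.Sieve.MkEps.EpsFunctionalLe 3 (1/2) 2`: for every `ε ∈ [0, 1/2]` and
every Polymath test function `F` on `(1+ε)·R₃` (Polymath 8b, arXiv:1407.4897, the `M_{k,ε}` functional of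
Theorem 3.12 at `k = 3`), `(Σᵢ J_{i,1-ε}(F)) / I(F) ≤ 2` — the GEH `k = 3` ceiling of the `ε`-trick.
This file only composes the route's three proved items through the route's deciding theorem `closes`:
`Assembly` (`assembly_holds`, stmt-Parity-19071), `GridBoundHigh` (`gridBoundHigh_proof`, stmt-Parity-19069:
the 24 kernel-checked Cauchy–Schwarz weight certificates at `ε = j/80`, `17 ≤ j ≤ 40`) and `GridBoundLow`
(`gridBoundLow_holds`, stmt-Parity-19070: `j ≤ 16` from `M_{3,0} ≤ (3/2) log 3` by dilation).
Rung F-P1 bookkeeping (the route's registered ALT-CLOSER leaf); nothing here proves the Parity summit.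
Standard axioms only (`propext`, `Classical.choice`, `Quot.sound`).
-/

namespace Summit.Parity.GeneralizedHardyLittlewood.Theses.PolymathEpsThreeCeiling

/-- **The route target `EpsThreeLeTwo` (stmt-Parity-19068), by name**: `M_{3,ε}(F) ≤ 2` for every `ε ∈ [0, 1/2]`
and every Polymath test function `F` at `(k, ε) = (3, ε)`, i.e.
`Literature.NumberTheory.Sieve.MkEps.EpsFunctionalLe 3 (1/2) 2` — the deciding theorem `closes` applied to the
proved items `assembly_holds`, `gridBoundHigh_proof`, `gridBoundLow_holds`. -/
theorem epsThreeLeTwo_proof :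
    Summit.Parity.GeneralizedHardyLittlewood.Theses.PolymathEpsThreeCeiling.EpsThreeLeTwo :=
  closes assembly_holds gridBoundHigh_proof gridBoundLow_holds

end Summit.Parity.GeneralizedHardyLittlewood.Theses.PolymathEpsThreeCeiling
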